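import Mathlib
import Summits.AtomisticToContinuum.Crystallization.Theses.ChessboardParticlePlanes
import Summits.AtomisticToContinuum.Crystallization.Theorems.ChessboardParticlePlanesLjLaminarWindowsOneWindowAllScales
import Literature.MathematicalPhysics.StatisticalMechanics.LennardJonesThermodynamicLimitProofs
import HarnessLib

/-!
# `LjLaminarWindows` is a statement about the SETS of ground states: the sequence-free residual — line `Sketch`,
skeleton rev. 20 (lead c13), crux stmt-AtomisticToContinuum-6711

The crux `LjLaminarWindows` of route `ChessboardParticlePlanes` quantifies over SEQUENCES of Lennard-Jones ground states
`(x^N)_N` and asks for laminar windows FREQUENTLY in `N`; rev. 19 (lead c12) certified that it is equivalent to its one-window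
laminarity clause at every scale, S9♭ (`LjLaminarWindows_iff_oneWindowAllScales`).  Because Lennard-Jones ground states EXIST for
every `N` (`exists_isGroundState_lennardJones`, Blanc–Lewin 2015 §1.2, a tree theorem), "frequently in `N` along EVERY sequence of
ground states" is the same as "for infinitely many `N`, for EVERY ground state of `N` particles" (`forall_groundStateSeq_frequently_iff`:
if along some tail every `N` had a bad ground state, choice assembles them — padded by arbitrary ground states before the tail — into a
sequence violating the hypothesis).  Hence the crux is equivalent to the sequence-free statement

* **S9♯** for every `η > 0` and every radius `L`, for infinitely many `N`, EVERY `N`-particle Lennard-Jones ground state `y` has a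
  particle `i`, a linear isometry `A` and a `3/4`-separated height set `T ⊂ ℝ` with every particle of the closed `L`-ball around `y i`
  within `η` of `T` in the rotated third coordinate

(`LjLaminarWindows_iff_allGroundStates`).  What a refutation must exhibit is therefore: ONE `η > 0`, ONE `L`, and for all large `N`
ONE ground state of `N` particles without an `η`-laminar particle-centred closed `L`-window; what a proof must show is a property of
all ground states at infinitely many particle numbers — the sequence in the crux carries no freedom.
-/

noncomputable section

open Filter
open Literature.MathematicalPhysics.StatisticalMechanics

namespace Summit.AtomisticToContinuum.Crystallization.Theorems.LjLaminarWindowsSketch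

/-- **Sequences of ground states carry no freedom.** For any property `P N y` of `N`-particle configurations: "`P` holds
frequently in `N` along every sequence of Lennard-Jones ground states in `ℝ³`" iff "for infinitely many `N`, `P` holds for EVERY
`N`-particle ground state".  (`←` is restriction; `→` by contraposition and choice: eventually pick a bad ground state, elsewhere
any ground state — they exist for every `N`, `exists_isGroundState_lennardJones`.) [folklore] -/
theorem forall_groundStateSeq_frequently_iff
    (P : (N : ℕ) → (Fin N → EuclideanSpace ℝ (Fin 3)) → Prop) :
    (∀ x : (N : ℕ) → (Fin N → EuclideanSpace ℝ (Fin 3)), (∀ N, IsGroundState lennardJones (x N)) →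
      ∃ᶠ N in Filter.atTop, P N (x N)) ↔
    ∃ᶠ N in Filter.atTop, ∀ y : Fin N → EuclideanSpace ℝ (Fin 3), IsGroundState lennardJones y → P N y := by
  classical
  constructor
  · intro h
    by_contra hno
    rw [Filter.not_frequently] at hno
    -- a sequence of ground states that is bad wherever a bad ground state exists
    let x : (N : ℕ) → (Fin N → EuclideanSpace ℝ (Fin 3)) := fun N =>
      if hN : ∃ y : Fin N → EuclideanSpace ℝ (Fin 3), IsGroundState lennardJones y ∧ ¬ P N y then hN.choose
      else (exists_isGroundState_lennardJones (d := 3) (by norm_num) N).choose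
    have hx : ∀ N, IsGroundState lennardJones (x N) := by
      intro N
      by_cases hN : ∃ y : Fin N → EuclideanSpace ℝ (Fin 3), IsGroundState lennardJones y ∧ ¬ P N y
      · simp only [x, dif_pos hN]
        exact hN.choose_spec.1
      · simp only [x, dif_neg hN]
        exact (exists_isGroundState_lennardJones (d := 3) (by norm_num) N).choose_spec
    have hbad : ∀ᶠ N in Filter.atTop, ¬ P N (x N) := by
      filter_upwards [hno] with N hN
      have hN' : ∃ y : Fin N → EuclideanSpace ℝ (Fin 3), IsGroundState lennardJones y ∧ ¬ P N y := by
        by_contra hc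
        push Not at hc
        exact hN hc
      simp only [x, dif_pos hN']
      exact hN'.choose_spec.2
    obtain ⟨N, hN₁, hN₂⟩ := ((h x hx).and_eventually hbad).exists
    exact hN₂ hN₁
  · intro h x hx
    exact h.mono fun N hN => hN (x N) (hx N)

/-- **`LjLaminarWindows` ↔ S9♯ (sequence-free, unconditional).** The crux of route `ChessboardParticlePlanes`
(stmt-AtomisticToContinuum-6711) holds iff for every `η > 0` and every radius `L`, for infinitely many `N`, EVERY Lennard-Jones
ground state `y` of `N` particles in `ℝ³` has a particle `i`, a linear isometry `A` and a `3/4`-separated `T ⊂ ℝ` such that every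
particle of the closed `L`-ball around `y i` lies within `η` of `T` in the rotated third coordinate.
(`LjLaminarWindows_iff_oneWindowAllScales` + `forall_groundStateSeq_frequently_iff`, quantifiers `η`, `L` commuted past the sequence.)
[folklore] -/
theorem LjLaminarWindows_iff_allGroundStates :
    Summit.AtomisticToContinuum.Crystallization.Theses.ChessboardParticlePlanes.LjLaminarWindows ↔
    ∀ η : ℝ, 0 < η → ∀ L : ℝ, ∃ᶠ N in Filter.atTop,
      ∀ y : Fin N → EuclideanSpace ℝ (Fin 3), IsGroundState lennardJones y →
        ∃ (i : Fin N) (A : EuclideanSpace ℝ (Fin 3) →ₗᵢ[ℝ] EuclideanSpace ℝ (Fin 3)) (T : Set ℝ),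
          (∀ t ∈ T, ∀ t' ∈ T, t ≠ t' → (3 : ℝ) / 4 ≤ |t - t'|) ∧
          (∀ j : Fin N, dist (y j) (y i) ≤ L → ∃ t ∈ T, |(A (y j - y i)) 2 - t| ≤ η) := by
  rw [LjLaminarWindows_iff_oneWindowAllScales]
  constructor
  · intro h η hη L
    rw [← forall_groundStateSeq_frequently_iff (fun N y =>
      ∃ (i : Fin N) (A : EuclideanSpace ℝ (Fin 3) →ₗᵢ[ℝ] EuclideanSpace ℝ (Fin 3)) (T : Set ℝ),
        (∀ t ∈ T, ∀ t' ∈ T, t ≠ t' → (3 : ℝ) / 4 ≤ |t - t'|) ∧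
        (∀ j : Fin N, dist (y j) (y i) ≤ L → ∃ t ∈ T, |(A (y j - y i)) 2 - t| ≤ η))]
    exact fun x hx => h x hx η hη L
  · intro h x hx η hη L
    exact (h η hη L).mono fun N hN => hN (x N) (hx N)

/-- **Closing recipe for the sequence-free residual**: S9♯ proves the crux. [folklore] -/
theorem LjLaminarWindows_of_allGroundStates
    (hAll : ∀ η : ℝ, 0 < η → ∀ L : ℝ, ∃ᶠ N in Filter.atTop,
      ∀ y : Fin N → EuclideanSpace ℝ (Fin 3), IsGroundState lennardJones y →
        ∃ (i : Fin N) (A : EuclideanSpace ℝ (Fin 3) →ₗᵢ[ℝ] EuclideanSpace ℝ (Fin 3)) (T : Set ℝ),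
          (∀ t ∈ T, ∀ t' ∈ T, t ≠ t' → (3 : ℝ) / 4 ≤ |t - t'|) ∧
          (∀ j : Fin N, dist (y j) (y i) ≤ L → ∃ t ∈ T, |(A (y j - y i)) 2 - t| ≤ η)) :
    Summit.AtomisticToContinuum.Crystallization.Theses.ChessboardParticlePlanes.LjLaminarWindows :=
  LjLaminarWindows_iff_allGroundStates.2 hAll

/-- **Eventual form ⇒ crux.** If for every `η > 0` and `L`, for ALL large `N`, every `N`-particle ground state has an `η`-laminar
particle-centred closed `L`-window (the physically expected statement), the crux follows. [folklore] -/
theorem LjLaminarWindows_of_eventually_allGroundStates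
    (hAll : ∀ η : ℝ, 0 < η → ∀ L : ℝ, ∀ᶠ N in Filter.atTop,
      ∀ y : Fin N → EuclideanSpace ℝ (Fin 3), IsGroundState lennardJones y →
        ∃ (i : Fin N) (A : EuclideanSpace ℝ (Fin 3) →ₗᵢ[ℝ] EuclideanSpace ℝ (Fin 3)) (T : Set ℝ),
          (∀ t ∈ T, ∀ t' ∈ T, t ≠ t' → (3 : ℝ) / 4 ≤ |t - t'|) ∧
          (∀ j : Fin N, dist (y j) (y i) ≤ L → ∃ t ∈ T, |(A (y j - y i)) 2 - t| ≤ η)) :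
    Summit.AtomisticToContinuum.Crystallization.Theses.ChessboardParticlePlanes.LjLaminarWindows :=
  LjLaminarWindows_of_allGroundStates fun η hη L => (hAll η hη L).frequently

end Summit.AtomisticToContinuum.Crystallization.Theorems.LjLaminarWindowsSketch

end
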